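import Summits.QuantumAdvantage.AdviceFreeQNC0.AffBells21Descent
import HarnessLib

/-!
# Cell qa-qnc0, plan S2 engine (ROUND-20 §2.8, class version): the coin-pair Cauchy–Schwarz DESCENT ON A PARITY CLASS
(DL-class) — planner qa-qnc0-p1 g21, `Sketch21.lean` §2c′, statements VERBATIM

Support for crux `RingDenseResidualLt3` (stmt-QuantumAdvantage-22907), route `DWalkThree`.  On a hard-core fibre the coins
are uniform on a PARITY CLASS (`Fib19.card_fibre_coinParity`), so the descent must be run INSIDE the class
`{F : #{j ∈ P : F_j} ≡ μ₀}`: for fixed coins off the pair `{a, b} ⊆ P` exactly two of the four values of `(F_a, F_b)` are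
admissible, whence TWO children per pair (`S_{00,11}`: rows with `B_a + B_b ≠ 0`; `S_{01,10}`: rows with `B_a ≠ B_b`),
each again on a parity class of the remaining coins `P' = P \ {a, b}` with `λ = 0`.

Objects VERBATIM from the planner's `exp21/Sketch21.lean` §2c′: `classBiasNum` (the signed count `N(S; P, μ₀)`) and the
statement `DescentLemmaClass`.  PROVED here (0 sorry): `descentLemmaClass : DescentLemmaClass`,
`4·N(S; P, μ₀)² ≤ 2·4^{q−1} + 2^{q−1}·(|N(S_{00,11}; P', μ₀)| + |N(S_{01,10}; P', ¬μ₀)|)`.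
Proof: the two-coordinate Cauchy–Schwarz `TwoModuli.sq_sum_le_sum_pair_overwrite` ([ViolaWigderson2008] differencing)
for the class-restricted summand `f = 𝟙_class · (−1)^{#hit + #λ}`; for every `F` the class test of the overwrite `F^x` is
`x_a ⊕ x_b ⊕ par(P', F) = μ₀` (`classCond_setPair_iff`), so `(Σ_x f(F^x))² = 2 + 2·s(F^x)s(F^{x̄})` with the admissible
complementary pair, and the cross term is `±` the class summand of the corresponding child by the sign lemma
`sign_pair_overwrite` of `AffBells21Descent`.

WHAT THIS IS NOT: no leaf bound on a class (class-Φ), no statement about the crux; the kernel instances of Sketch21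
(`descentClass_instances`, `native_decide`) are not repeated.
-/

namespace Summit.QuantumAdvantage.AdviceFreeQNC0

open Finset
open Literature.Computability.MetaComplexity

namespace AffBells21

/-! ## §2c′ statements (planner qa-qnc0-p1 g21, Sketch21.lean §2c′ — VERBATIM) -/

/-- Signed count of the parity of the system on the coin PARITY CLASS `Σ_{j ∈ P} F_j ≡ μ₀`. -/
def classBiasNum (q s : ℕ) (B : Fin s → Fin q → ZMod 3) (r : Fin s → ZMod 3) (lam : Fin q → Bool)
    (P : Finset (Fin q)) (μ₀ : Bool) : ℤ :=
  ∑ F : Fin q → Bool,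
    if ((P.filter fun j => F j = true).card % 2 = 1) = (μ₀ = true) then
      (-1 : ℤ) ^ (((univ.filter fun k : Fin s => (∑ j : Fin q, if F j then B k j else 0) = r k).card
                  + (univ.filter fun j : Fin q => lam j = true ∧ F j = true).card))
    else 0

/-- **(DL-class) DESCENT LEMMA ON A PARITY CLASS** (support): with `P' = P \ {a,b}` (`a, b ∈ P`, `a ≠ b`) and classes of size `2^{q−1}`,
`4·N(S)² ≤ 2·4^{q−1} + 2^{q−1}·(|N(S_{00,11}; P', μ₀)| + |N(S_{01,10}; P', ¬μ₀)|)`, i.e.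
`bias_cl² ≤ 1/2 + (1/4)(|bias_cl(S_{00,11})| + |bias_cl(S_{01,10})|)`. -/
def DescentLemmaClass : Prop :=
  ∀ (q s : ℕ) (B : Fin s → Fin q → ZMod 3) (r : Fin s → ZMod 3) (lam : Fin q → Bool) (P : Finset (Fin q)) (μ₀ : Bool)
    (a b : Fin q), a ∈ P → b ∈ P → a ≠ b →
    4 * (classBiasNum q s B r lam P μ₀) ^ 2
      ≤ 2 * 4 ^ (q - 1)
        + 2 ^ (q - 1) * (|classBiasNum q s (childB B a b (false, false) (true, true)) (childR B r a b (false, false) (true, true))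
                              (fun _ => false) ((P.erase a).erase b) μ₀|
                         + |classBiasNum q s (childB B a b (false, true) (true, false)) (childR B r a b (false, true) (true, false))
                              (fun _ => false) ((P.erase a).erase b) (!μ₀)|)

/-! ## Bookkeeping: the class condition under a pair overwrite -/

variable {q s : ℕ}

/-- `#{j ∈ P : F^x_j} = [x_a] + [x_b] + #{j ∈ P \ {a,b} : F_j}` for `a, b ∈ P`, `a ≠ b`. -/
theorem card_filter_setPair {P : Finset (Fin q)} {a b : Fin q} (ha : a ∈ P) (hb : b ∈ P) (hab : a ≠ b)
    (x : Bool × Bool) (F : Fin q → Bool) :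
    (P.filter fun j => setPair a b x F j = true).card
      = (if x.1 = true then 1 else 0) + (if x.2 = true then 1 else 0)
        + (((P.erase a).erase b).filter fun j => F j = true).card := by
  have hb' : b ∈ P.erase a := Finset.mem_erase.mpr ⟨hab.symm, hb⟩
  rw [card_filter, card_filter, ← Finset.add_sum_erase P _ ha, ← Finset.add_sum_erase (P.erase a) _ hb',
    setPair_apply_left hab, setPair_apply_right, add_assoc]
  congr 2
  refine sum_congr rfl fun j hj => ?_
  have hjb : j ≠ b := (Finset.mem_erase.mp hj).1
  have hja : j ≠ a := (Finset.mem_erase.mp (Finset.mem_erase.mp hj).2).1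
  rw [setPair_apply_of_ne hja hjb]

/-- The parity bit of `#{j ∈ P' : F_j}`. -/
def parBit (P' : Finset (Fin q)) (F : Fin q → Bool) : Bool := decide ((P'.filter fun j => F j = true).card % 2 = 1)

/-- `decide p = μ₀ ↔ (p = (μ₀ = true))` (the class test of `classBiasNum` as a Boolean equation). -/
theorem decide_eq_bool_iff (p : Prop) [Decidable p] (μ₀ : Bool) : (p = (μ₀ = true)) ↔ decide p = μ₀ := by
  cases μ₀
  · simp
  · simp

/-- The class test after the overwrite: `F^x ∈ class(P, μ₀) ⟺ x_a ⊕ x_b ⊕ par(P', F) = μ₀`. -/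
theorem classCond_setPair_iff {P : Finset (Fin q)} {a b : Fin q} (ha : a ∈ P) (hb : b ∈ P) (hab : a ≠ b)
    (μ₀ : Bool) (x : Bool × Bool) (F : Fin q → Bool) :
    (((P.filter fun j => setPair a b x F j = true).card % 2 = 1) = (μ₀ = true))
      ↔ (xor (xor x.1 x.2) (parBit ((P.erase a).erase b) F)) = μ₀ := by
  rw [card_filter_setPair ha hb hab, decide_eq_bool_iff]
  unfold parBit
  set m := (((P.erase a).erase b).filter fun j => F j = true).card
  rcases Nat.mod_two_eq_zero_or_one m with hm | hm <;>
    rcases x with ⟨_ | _, _ | _⟩ <;> cases μ₀ <;> simp [Nat.add_mod, hm]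

/-- The class test on the untouched coins, as a Boolean equation. -/
theorem classCond_iff (P' : Finset (Fin q)) (μ : Bool) (F : Fin q → Bool) :
    (((P'.filter fun j => F j = true).card % 2 = 1) = (μ = true)) ↔ parBit P' F = μ := by
  unfold parBit
  exact decide_eq_bool_iff _ _

/-- `((−1)^n)² = 1`. -/
theorem neg_one_pow_sq (n : ℕ) : ((-1 : ℝ) ^ n) ^ 2 = 1 := by
  rw [← pow_mul, mul_comm, pow_mul, neg_one_sq, one_pow]

/-! ## (DL-class) the descent lemma on a parity class -/

/-- **(DL-class) PROVED**: `4·N(S; P, μ₀)² ≤ 2·4^{q−1} + 2^{q−1}(|N(S_{00,11}; P', μ₀)| + |N(S_{01,10}; P', ¬μ₀)|)`.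
Two-coordinate Cauchy–Schwarz (`TwoModuli.sq_sum_le_sum_pair_overwrite`) for the class-restricted summand; for each
`F` exactly two of the four overwrites `F^x` lie in the class (`x_a ⊕ x_b` fixed by the parity of the other coins of `P`),
so `(Σ_x f(F^x))² = 2 + 2·s(F^x)s(F^{x̄})`, and the cross term is `±` the class summand of the corresponding child
(`sign_pair_overwrite`). -/
theorem descentLemmaClass : DescentLemmaClass := by
  intro q s B r lam P μ₀ a b ha hb hab
  -- notation
  set P' := (P.erase a).erase b with hP'
  set sgn : (Fin q → Bool) → ℝ := fun F => (-1 : ℝ) ^ ((univ.filter fun k : Fin s => rowSum B k F = r k).card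
      + (univ.filter fun j : Fin q => lam j = true ∧ F j = true).card) with hsgn
  set f : (Fin q → Bool) → ℝ := fun F =>
      if ((P.filter fun j => F j = true).card % 2 = 1) = (μ₀ = true) then sgn F else 0 with hf
  -- the two child summands
  set t₁ : (Fin q → Bool) → ℝ := fun F => (-1 : ℝ) ^
      ((univ.filter fun k : Fin s => rowSum (childB B a b (false, false) (true, true)) k F
          = childR B r a b (false, false) (true, true) k).card
        + (univ.filter fun j : Fin q => (fun _ : Fin q => false) j = true ∧ F j = true).card) with ht₁
  set t₂ : (Fin q → Bool) → ℝ := fun F => (-1 : ℝ) ^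
      ((univ.filter fun k : Fin s => rowSum (childB B a b (false, true) (true, false)) k F
          = childR B r a b (false, true) (true, false) k).card
        + (univ.filter fun j : Fin q => (fun _ : Fin q => false) j = true ∧ F j = true).card) with ht₂
  set ε₁ : ℝ := (-1 : ℝ) ^ (survCount B a b (false, false) (true, true) + lamCount lam a b (false, false) (true, true))
    with hε₁
  set ε₂ : ℝ := (-1 : ℝ) ^ (survCount B a b (false, true) (true, false) + lamCount lam a b (false, true) (true, false))
    with hε₂
  set N₁ : ℝ := ∑ F : Fin q → Bool, if parBit P' F = μ₀ then t₁ F else 0 with hN₁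
  set N₂ : ℝ := ∑ F : Fin q → Bool, if parBit P' F = !μ₀ then t₂ F else 0 with hN₂
  -- casts of the three integer counts
  have hN : (classBiasNum q s B r lam P μ₀ : ℝ) = ∑ F, f F := by
    unfold classBiasNum; push_cast; rfl
  have hN₁c : (classBiasNum q s (childB B a b (false, false) (true, true)) (childR B r a b (false, false) (true, true))
      (fun _ => false) ((P.erase a).erase b) μ₀ : ℝ) = N₁ := by
    unfold classBiasNum
    push_cast
    refine sum_congr rfl fun F _ => ?_
    rw [← hP']
    exact if_congr (classCond_iff P' μ₀ F) rfl rfl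
  have hN₂c : (classBiasNum q s (childB B a b (false, true) (true, false)) (childR B r a b (false, true) (true, false))
      (fun _ => false) ((P.erase a).erase b) (!μ₀) : ℝ) = N₂ := by
    unfold classBiasNum
    push_cast
    refine sum_congr rfl fun F _ => ?_
    rw [← hP']
    exact if_congr (classCond_iff P' (!μ₀) F) rfl rfl
  -- signs of the overwrites: cross terms are ± child summands
  have hx11 : ∀ F, sgn (setPair a b (false, false) F) * sgn (setPair a b (true, true) F) = ε₁ * t₁ F :=
    fun F => sign_pair_overwrite hab B r lam (false, false) (true, true) F
  have hx10 : ∀ F, sgn (setPair a b (false, true) F) * sgn (setPair a b (true, false) F) = ε₂ * t₂ F :=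
    fun F => sign_pair_overwrite hab B r lam (false, true) (true, false) F
  have hsq : ∀ F x, sgn (setPair a b x F) ^ 2 = 1 := fun F x => neg_one_pow_sq _
  -- the square of the four-term overwrite sum, pointwise in F
  have hfour : ∀ F, (∑ x : Bool × Bool, f (setPair a b x F)) ^ 2
      = 2 + 2 * ((if parBit P' F = μ₀ then ε₁ * t₁ F else 0) + (if parBit P' F = !μ₀ then ε₂ * t₂ F else 0)) := by
    intro F
    have hfx : ∀ x : Bool × Bool, f (setPair a b x F)
        = if (xor (xor x.1 x.2) (parBit P' F)) = μ₀ then sgn (setPair a b x F) else 0 := by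
      intro x
      simp only [hf]
      exact if_congr (classCond_setPair_iff ha hb hab μ₀ x F) rfl rfl
    simp only [hfx, Fintype.sum_prod_type, Fintype.sum_bool]
    rw [← hx11 F, ← hx10 F]
    have h1 := hsq F (true, true); have h2 := hsq F (true, false)
    have h3 := hsq F (false, true); have h4 := hsq F (false, false)
    cases hπ : parBit P' F <;> cases μ₀ <;> simp <;> nlinarith [h1, h2, h3, h4]
  -- two-coordinate Cauchy–Schwarz and the evaluation of the right-hand side
  have hCS := TwoModuli.sq_sum_le_sum_pair_overwrite f hab
  rw [Fintype.card_fin] at hCS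
  have hRHS : ∑ x : Bool × Bool, ∑ x' : Bool × Bool, ∑ F : Fin q → Bool,
      f (Function.update (Function.update F a x.1) b x.2) * f (Function.update (Function.update F a x'.1) b x'.2)
        = 2 * 2 ^ q + 2 * (ε₁ * N₁ + ε₂ * N₂) := by
    have hswap : ∑ x : Bool × Bool, ∑ x' : Bool × Bool, ∑ F : Fin q → Bool,
        f (Function.update (Function.update F a x.1) b x.2) * f (Function.update (Function.update F a x'.1) b x'.2)
          = ∑ F : Fin q → Bool, (∑ x : Bool × Bool, f (setPair a b x F)) ^ 2 := by
      calc ∑ x : Bool × Bool, ∑ x' : Bool × Bool, ∑ F : Fin q → Bool,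
            f (Function.update (Function.update F a x.1) b x.2) * f (Function.update (Function.update F a x'.1) b x'.2)
          = ∑ x : Bool × Bool, ∑ F : Fin q → Bool, ∑ x' : Bool × Bool,
            f (Function.update (Function.update F a x.1) b x.2)
              * f (Function.update (Function.update F a x'.1) b x'.2) := sum_congr rfl fun x _ => sum_comm
        _ = ∑ F : Fin q → Bool, ∑ x : Bool × Bool, ∑ x' : Bool × Bool,
            f (Function.update (Function.update F a x.1) b x.2)
              * f (Function.update (Function.update F a x'.1) b x'.2) := sum_comm
        _ = ∑ F : Fin q → Bool, (∑ x : Bool × Bool, f (setPair a b x F)) ^ 2 := by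
            refine sum_congr rfl fun F _ => ?_
            rw [sq, sum_mul_sum]
            rfl
    rw [hswap, sum_congr rfl fun F _ => hfour F]
    have hA : ∑ F : Fin q → Bool, (if parBit P' F = μ₀ then ε₁ * t₁ F else 0) = ε₁ * N₁ := by
      rw [hN₁, mul_sum]
      refine sum_congr rfl fun F _ => ?_
      split_ifs <;> simp
    have hB : ∑ F : Fin q → Bool, (if parBit P' F = !μ₀ then ε₂ * t₂ F else 0) = ε₂ * N₂ := by
      rw [hN₂, mul_sum]
      refine sum_congr rfl fun F _ => ?_
      split_ifs <;> simp
    have hcard : (Finset.univ : Finset (Fin q → Bool)).card = 2 ^ q := by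
      rw [card_univ, Fintype.card_fun, Fintype.card_bool, Fintype.card_fin]
    rw [sum_add_distrib, sum_const, hcard, ← mul_sum, sum_add_distrib, hA, hB]
    simp only [nsmul_eq_mul, Nat.cast_pow, Nat.cast_ofNat]
    ring
  rw [hRHS] at hCS
  -- bound the signed child terms by absolute values
  have hε₁abs : |ε₁| = 1 := abs_neg_one_pow _
  have hε₂abs : |ε₂| = 1 := abs_neg_one_pow _
  have hb1 : ε₁ * N₁ ≤ |N₁| := by
    calc ε₁ * N₁ ≤ |ε₁ * N₁| := le_abs_self _
      _ = |N₁| := by rw [abs_mul, hε₁abs, one_mul]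
  have hb2 : ε₂ * N₂ ≤ |N₂| := by
    calc ε₂ * N₂ ≤ |ε₂ * N₂| := le_abs_self _
      _ = |N₂| := by rw [abs_mul, hε₂abs, one_mul]
  -- q ≥ 2
  have hq : 2 ≤ q := by
    have h1 : ({a, b} : Finset (Fin q)).card = 2 := card_pair hab
    have h2 : ({a, b} : Finset (Fin q)).card ≤ q := by
      simpa using Finset.card_le_univ ({a, b} : Finset (Fin q))
    omega
  obtain ⟨q', rfl⟩ : ∃ q', q = q' + 1 := ⟨q - 1, by omega⟩
  rw [Nat.add_sub_cancel]
  -- assemble (in ℝ, then cast)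
  have hreal : 4 * (classBiasNum (q' + 1) s B r lam P μ₀ : ℝ) ^ 2
      ≤ 2 * 4 ^ q' + 2 ^ q' * (|(classBiasNum (q' + 1) s (childB B a b (false, false) (true, true))
            (childR B r a b (false, false) (true, true)) (fun _ => false) ((P.erase a).erase b) μ₀ : ℝ)|
          + |(classBiasNum (q' + 1) s (childB B a b (false, true) (true, false))
            (childR B r a b (false, true) (true, false)) (fun _ => false) ((P.erase a).erase b) (!μ₀) : ℝ)|) := by
    rw [hN, hN₁c, hN₂c]
    have h4 : (4 : ℝ) ^ q' = 2 ^ q' * 2 ^ q' := by rw [← mul_pow]; norm_num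
    have hpos : (0 : ℝ) ≤ 2 ^ q' := by positivity
    have hCS' : (∑ F, f F) ^ 2 ≤ 2 ^ (q' + 1) / 16 * (2 * 2 ^ (q' + 1) + 2 * (ε₁ * N₁ + ε₂ * N₂)) := hCS
    have hexp : (2 : ℝ) ^ (q' + 1) / 16 * (2 * 2 ^ (q' + 1) + 2 * (ε₁ * N₁ + ε₂ * N₂))
        = 2 ^ q' * 2 ^ q' / 2 + (2 ^ q' * (ε₁ * N₁) + 2 ^ q' * (ε₂ * N₂)) / 4 := by
      rw [pow_succ]; ring
    rw [hexp] at hCS'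
    have e1 : (2 : ℝ) ^ q' * (ε₁ * N₁) ≤ 2 ^ q' * |N₁| := mul_le_mul_of_nonneg_left hb1 hpos
    have e2 : (2 : ℝ) ^ q' * (ε₂ * N₂) ≤ 2 ^ q' * |N₂| := mul_le_mul_of_nonneg_left hb2 hpos
    rw [h4, mul_add]
    linarith [hCS', e1, e2]
  exact_mod_cast hreal

end AffBells21

end Summit.QuantumAdvantage.AdviceFreeQNC0
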